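import Summits.PneNP.PneNP.Theorems.NegLimitedAmplifiedWindowDefs
import Mathlib
import HarnessLib

/-!
# Route NegLimited — line `amplified-window`, stub `stub_doorAssembly` (rung F-N1/p3, ROUND-11)

Registered stub (DA) of the skeleton `amplified-window` on the door item
`NegLimited.NeglimitedEpsLogNegationsR` (stmt-PneNP-19860; HOME/pnp-ideate-p3/r11/amplified-window.lean
v2 sha c828757ca2bc7a67; card r11/amplified-window.md §Stubs 2):

  `DoorAssembly := CorrelationNegationsTransfer → AmplifiedCliqueSlicesNP → AmplifiedCliqueCorrelation →
     NegLimited.NeglimitedEpsLogNegationsR`.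

Asymptotic arithmetic only (template: `Theorems/NegLimitedDoorOfPlantedClique.lean`).  With the engine's
`ε`, take door-`ε' := ε/2`.  For the exponent `c`, the engine gives a clique size `k` and, for all large
`n`, the monotone balanced function `F = RM3_{⌊log₃ n⌋} ⊗ CLIQUE(n,k)` that is `(½ + ℓ^{−ε})`-hard for
size-`ℓ^c` monotone circuits under an FKG-lattice weight (`ℓ = ampLen n k`).  If a De Morgan circuit `D`
of size `≤ ℓ^c` with `≤ b = ⌊ε'·log₂ ℓ⌋₊` NOT gates computed `F`, the transfer (T) — monotone members have
size `≤ D.size ≤ ℓ^c` and `monotoneBasis ⊆ monotoneBasis01` — would give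
`1 ≤ (2^{b+1} − 1)·2ℓ^{−ε} ≤ 4·ℓ^{ε/2}·ℓ^{−ε} = 4ℓ^{−ε/2} < 1` for large `ℓ` (`two_pow_budget_le'`,
`ℓ ≥ n`): impossible.  (S) transports the size bound `ℓ^c + 1` to the monotone slice of its NP language
at length `ℓ`, and `ℓ = ampLen n k ≥ n` is unbounded, so the door holds `∃ᶠ ℓ`.

HONEST FRAMING: assembly only; the inputs (E) ⇐ (B)+(A) are OPEN stubs of the line (`stub_criticalWindow`,
`stub_monotoneAmplification`); nothing is claimed about them here; FRONTIER rung F-N1 — nothing here bears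
on P vs NP.
-/

set_option linter.dupNamespace false -- `Summit.PneNP.PneNP.…`: summit = sub-problem name (D-0017 single-conjunct layout)

namespace Summit.PneNP.PneNP.Theorems.NegLimitedAmplifiedWindow

open Finset Filter
open Literature.Computability.Complexity
open Summit.PneNP.PneNP.Theorems.NegLimitedDoor (massAt agreeAt)

/-! ### Helpers -/

/-- The NOT budget: `2^{⌊(ε/2)·log₂ ℓ⌋₊ + 1} ≤ 2·ℓ^{ε/2}` for `ℓ ≥ 1`, `ε ≥ 0`. -/
theorem two_pow_budget_le' {ε : ℝ} (hε : 0 ≤ ε) {ℓ : ℕ} (hℓ : 1 ≤ ℓ) :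
    (2 : ℝ) ^ (⌊ε / 2 * Real.logb 2 (ℓ : ℝ)⌋₊ + 1) ≤ 2 * (ℓ : ℝ) ^ (ε / 2) := by
  have hℓ0 : (0 : ℝ) < ℓ := by exact_mod_cast hℓ
  have hlog0 : 0 ≤ Real.logb 2 (ℓ : ℝ) := Real.logb_nonneg one_lt_two (by exact_mod_cast hℓ)
  have hfloor : (⌊ε / 2 * Real.logb 2 (ℓ : ℝ)⌋₊ : ℝ) ≤ ε / 2 * Real.logb 2 ℓ :=
    Nat.floor_le (by positivity)
  have hpow : (2 : ℝ) ^ (⌊ε / 2 * Real.logb 2 (ℓ : ℝ)⌋₊ : ℝ) ≤ (ℓ : ℝ) ^ (ε / 2) := by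
    calc (2 : ℝ) ^ (⌊ε / 2 * Real.logb 2 (ℓ : ℝ)⌋₊ : ℝ)
        ≤ (2 : ℝ) ^ (ε / 2 * Real.logb 2 ℓ) := Real.rpow_le_rpow_of_exponent_le one_le_two hfloor
      _ = ((2 : ℝ) ^ (Real.logb 2 ℓ)) ^ (ε / 2) := by
          rw [← Real.rpow_mul (by norm_num), mul_comm]
      _ = (ℓ : ℝ) ^ (ε / 2) := by rw [Real.rpow_logb two_pos (by norm_num) hℓ0]
  calc (2 : ℝ) ^ (⌊ε / 2 * Real.logb 2 (ℓ : ℝ)⌋₊ + 1)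
      = 2 * (2 : ℝ) ^ (⌊ε / 2 * Real.logb 2 (ℓ : ℝ)⌋₊ : ℝ) := by
        rw [pow_succ, mul_comm, Real.rpow_natCast]
    _ ≤ 2 * (ℓ : ℝ) ^ (ε / 2) := by linarith

/-- Eventually `4·n^{-ε/2} < 1` (for `ε > 0`). -/
theorem eventually_four_mul_rpow_neg_lt {ε : ℝ} (hε : 0 < ε) :
    ∀ᶠ n : ℕ in atTop, 4 * (n : ℝ) ^ (-(ε / 2)) < 1 := by
  have ht : Tendsto (fun n : ℕ => (n : ℝ) ^ (ε / 2)) atTop atTop :=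
    (tendsto_rpow_atTop (by positivity)).comp tendsto_natCast_atTop_atTop
  filter_upwards [ht.eventually_ge_atTop 5, eventually_ge_atTop 1] with n hn hn1
  have hn0 : (0 : ℝ) < n := by exact_mod_cast hn1
  have hpos : 0 < (n : ℝ) ^ (ε / 2) := Real.rpow_pos_of_pos hn0 _
  rw [Real.rpow_neg hn0.le]
  rw [show (4 : ℝ) * ((n : ℝ) ^ (ε / 2))⁻¹ = 4 / (n : ℝ) ^ (ε / 2) by ring]
  rw [div_lt_iff₀ hpos]
  linarith

/-- `n ≤ ampLen n k`. -/
theorem le_ampLen (n k : ℕ) : n ≤ ampLen n k := by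
  unfold ampLen
  have h1 : n ≤ n * n := Nat.le_mul_self n
  have h2 : n * n ≤ 3 ^ Nat.log 3 n * (n * n) :=
    Nat.le_mul_of_pos_left _ (Nat.one_le_pow _ _ (by norm_num))
  omega

/-! ### The stub -/

/-- **Registered stub `stub_doorAssembly`** of the skeleton `amplified-window` (stmt-PneNP-19860):
transfer (T) + slices (S) + the engine's output (E) ⟹ the door `NegLimited.NeglimitedEpsLogNegationsR`
with `ε' = ε/2`, along the lengths `ℓ = ampLen n k(c)`. -/
theorem stub_doorAssembly : DoorAssembly := by
  intro hT hS hE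
  obtain ⟨L, hLNP, hL⟩ := hS
  obtain ⟨ε, hε, hEc⟩ := hE
  refine ⟨L, hLNP, ε / 2, by positivity, fun c => ?_⟩
  obtain ⟨k, hk3, hev⟩ := hEc c
  -- everything happens eventually in `n`, at the length `ℓ = ampLen n k`
  have hmain : ∀ᶠ n : ℕ in atTop, Monotone (L.sliceFn (ampLen n k)) ∧
      (ampLen n k) ^ c < negLimitedSizeOver deMorganBasis
        ⌊ε / 2 * Real.logb 2 ((ampLen n k : ℕ) : ℝ)⌋₊ (L.sliceFn (ampLen n k)) := by
    filter_upwards [hev, eventually_gt_atTop k, eventually_four_mul_rpow_neg_lt hε]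
      with n hEn hkn hsmall
    obtain ⟨hFmono, ν, hν0, hνfkg, hνt, hνf, hhard⟩ := hEn
    obtain ⟨hmono, htransfer⟩ := hL n k hk3 hkn
    refine ⟨hmono, ?_⟩
    set ℓ := ampLen n k with hℓ
    set b := ⌊ε / 2 * Real.logb 2 ((ℓ : ℕ) : ℝ)⌋₊ with hb
    have hn1 : 1 ≤ n := by omega
    have hℓ1 : 1 ≤ ℓ := hn1.trans (le_ampLen n k)
    have hℓ0 : (0 : ℝ) < ℓ := by exact_mod_cast hℓ1
    have hnℓ : (n : ℝ) ≤ ℓ := by exact_mod_cast le_ampLen n k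
    -- every De Morgan circuit with `≤ b` NOTs computing `F` is large
    have hbig : ∀ D : Circuit ((Fin (Nat.log 3 n) → Fin 3) × Edge n), D.IsOver deMorganBasis →
        D.Computes (ampFn (Nat.log 3 n) (cliqueFn n k)) → D.negationCount ≤ b → ℓ ^ c + 1 ≤ D.size := by
      intro D hD hcomp hneg
      by_contra hlt
      have hsize : D.size ≤ ℓ ^ c := by omega
      -- the transfer with `δ = ℓ^{-ε}`
      have h1 : (1 : ℝ) ≤ ((2 : ℝ) ^ (b + 1) - 1) * (2 * (ℓ : ℝ) ^ (-ε)) := by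
        refine hT ((Fin (Nat.log 3 n) → Fin 3) × Edge n) ν hν0 hνfkg
          (ampFn (Nat.log 3 n) (cliqueFn n k)) hFmono (by rw [hνf, hνt]) (by rw [hνt]; norm_num)
          D b ((ℓ : ℝ) ^ (-ε)) hD hcomp hneg ?_
        intro M hM hMs
        have hM01 : M.IsOver monotoneBasis01 := hM.mono monotoneBasis_subset_monotoneBasis01
        have h := hhard M hM01 (hMs.trans hsize)
        rw [hνf, hνt]
        norm_num
        exact h
      -- but `(2^{b+1} − 1)·2ℓ^{−ε} ≤ 4 ℓ^{−ε/2} < 1`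
      have hbud := two_pow_budget_le' hε.le hℓ1
      have hℓε : 0 < (ℓ : ℝ) ^ (-ε) := Real.rpow_pos_of_pos hℓ0 _
      have h2 : ((2 : ℝ) ^ (b + 1) - 1) * (2 * (ℓ : ℝ) ^ (-ε)) < 1 := by
        calc ((2 : ℝ) ^ (b + 1) - 1) * (2 * (ℓ : ℝ) ^ (-ε))
            ≤ (2 * (ℓ : ℝ) ^ (ε / 2)) * (2 * (ℓ : ℝ) ^ (-ε)) :=
              mul_le_mul_of_nonneg_right (by linarith) (by positivity)
          _ = 4 * (ℓ : ℝ) ^ (-(ε / 2)) := by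
              rw [show (2 * (ℓ : ℝ) ^ (ε / 2)) * (2 * (ℓ : ℝ) ^ (-ε)) =
                  4 * ((ℓ : ℝ) ^ (ε / 2) * (ℓ : ℝ) ^ (-ε)) by ring, ← Real.rpow_add hℓ0]
              ring_nf
          _ ≤ 4 * (n : ℝ) ^ (-(ε / 2)) := by
              have hn0 : (0 : ℝ) < n := by exact_mod_cast hn1
              exact mul_le_mul_of_nonneg_left
                (Real.rpow_le_rpow_of_nonpos hn0 hnℓ (by linarith)) (by norm_num)
          _ < 1 := hsmall
      linarith
    exact htransfer b (ℓ ^ c + 1) hbig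
  -- the lengths `ampLen n k ≥ n` are cofinal: `∃ᶠ ℓ`
  rw [Filter.frequently_atTop]
  intro a
  obtain ⟨N, hN⟩ := Filter.eventually_atTop.1 hmain
  refine ⟨ampLen (max a N) k, (le_max_left a N).trans (le_ampLen _ _), hN _ (le_max_right _ _)⟩

end Summit.PneNP.PneNP.Theorems.NegLimitedAmplifiedWindow
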